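import Literature.AlgebraicGeometry.Resolution.SncModelSpread
import Literature.AlgebraicGeometry.Resolution.StrictNormalCrossingsFromRegularSequences
import Literature.AlgebraicGeometry.Resolution.CanonicalResolutionSmoothCentre
import HarnessLib

/-!
# Simple normal crossings in the fibres of a family, from smooth saturated strata

Topic: `Literature/AlgebraicGeometry/Resolution`. The FIBRE half of the simple normal crossings
bookkeeping for the spreading-out argument (`SpreadsShapedFromGenericPoint`,
`CanonicalResolutionSpread.lean`; BGMW 2011, Def. 3.1.1 / Def. 3.1.3 (2)), matching the model
data produced on the generic fibre in `SncSaturatedCentre.lean` and spread over the base by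
smoothness (`SmoothGenericFibreSpread.lean`) and the Cartier locus
(`EffectiveCartierStalks.lean`). Setting: `q : X → Spec D` locally Noetherian, a fibre
`ι : X_k → X` over a field-valued point (`IsPullback ι sk q (Spec k → Spec D)`), a boundary `E`
and a centre `C` on `X`.

* `hasSNCWith_comap_of_smooth_satCentre` — **`HasSNCWith (ι^*E) (ι^*C)` in the fibre** provided:
  (fibre) `ι^*E` has simple normal crossings (in the application: persistence under the previous
  blow-ups, `BlowupSNC.lean`); (model) for all finite sets `B, T` of members of `E`, the saturated
  stratum `V(satCentre C B ⊔ ∑_{K∈T} K)` is SMOOTH over `Spec D`, and every `D₀ ∈ B ∖ T`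
  restricts on it to an effective Cartier divisor whose zero scheme is FLAT over `Spec D`.
  Proof: the fibre-side criterion `hasSNCWith_of_nonZeroDivisor_data`
  (`StrictNormalCrossingsFromRegularSequences.lean`) at a point `x` of `V(ι^*C)` with `J = (ι^*C)_x`
  and `B = ` the members of `E` whose fibre equation is NOT in `J`: the key computation
  `stalkIdeal_comap_satCentre_eq` shows `(ι^* satCentre C B)_x = J` (an element `c` with
  `(∏ D)ⁿ c ∈ C_y` maps into `J` because the product of the fibre equations is outside the prime
  `J`), so the smooth stratum specializes to the regular subscheme with stalk `J + (f_T)` and the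
  relative Cartier divisor to a non-zero-divisor modulo it (`BlowupsRelativeCartier.lean`); the
  boundary-only hypotheses come from `HasSNC (ι^*E)` (`HasSNC.nonZeroDivisor_data`).

## Sources

* E. Bierstone, D. Grigoriev, P. Milman, J. Włodarczyk, arXiv:1206.3090, Def. 3.1.1,
  Def. 3.1.3 (2). [BierstoneGrigorievMilmanWlodarczyk2011]
* The Stacks Project, Tag 056P (relative effective Cartier divisors), Tag 056S.
  [StacksProject]
* H. Matsumura, *Commutative Ring Theory* (1986), Thm. 14.2. [Matsumura1987]
-/

noncomputable section

open CategoryTheory CategoryTheory.Limits AlgebraicGeometry TopologicalSpace IsLocalRing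

namespace Literature.AlgebraicGeometry.Resolution

universe u

open Scheme.IdealSheafData

/-! ## Boundary-only data from `HasSNC` -/

section BoundaryData

variable {Y : Scheme.{u}}

/-- Generators of equal principal ideals of a domain differ by a unit. [folklore] -/
theorem exists_isUnit_mul_eq_of_span_singleton_eq {R : Type*} [CommRing R] [IsDomain R] {a b : R}
    (h : Ideal.span {a} = Ideal.span {b}) : ∃ v : R, IsUnit v ∧ a = v * b := by
  obtain ⟨v, hv⟩ := (Ideal.span_singleton_eq_span_singleton.mp h).symm
  exact ⟨v, v.isUnit, by rw [← hv, mul_comm]⟩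

/-- **The boundary-only hypotheses of `hasSNCWith_of_nonZeroDivisor_data` hold for any choice of
generators under `HasSNC E`**: if `f_D` generates `D_x` for the divisors `D ∈ E` through `x`,
then `𝒪_{X,x}/(f_T)` is regular and `f_D` is a non-zero-divisor modulo `(f_T)` for `D ∉ T`
(the `f_D` are unit multiples of members of one regular system of parameters).
[cite: BierstoneGrigorievMilmanWlodarczyk2011, Def. 3.1.1] -/
theorem HasSNC.nonZeroDivisor_data {E : List Y.IdealSheafData} (hE : HasSNC E)
    (f : ∀ x : Y, Y.IdealSheafData → Y.presheaf.stalk x)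
    (hf : ∀ x : Y, ∀ D ∈ E, x ∈ D.support → stalkIdeal D x = Ideal.span {f x D})
    (x : Y) (T : Finset Y.IdealSheafData) (hT : ∀ D ∈ T, D ∈ E ∧ x ∈ D.support) :
    IsRegularLocalRing (Y.presheaf.stalk x ⧸ Ideal.span (f x '' (T : Set Y.IdealSheafData))) ∧
      ∀ D ∈ E, x ∈ D.support → D ∉ T →
        Ideal.Quotient.mk (Ideal.span (f x '' (T : Set Y.IdealSheafData))) (f x D) ∈
          nonZeroDivisors (Y.presheaf.stalk x ⧸ Ideal.span (f x '' (T : Set Y.IdealSheafData))) := by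
  classical
  obtain ⟨hreg, u, hu, ⟨ι, hιinj, hι⟩, -⟩ := hE x
  haveI := hreg
  haveI := isDomain_of_isRegularLocalRing (Y.presheaf.stalk x)
  -- `(f_T) = (u_{ι T})`
  set S : Finset (Fin (maximalIdeal (Y.presheaf.stalk x)).spanFinrank) :=
    T.attach.image fun K => ι ⟨K.1, (hT K.1 K.2).1, (hT K.1 K.2).2⟩ with hS
  have hspan : Ideal.span (f x '' (T : Set Y.IdealSheafData)) =
      Ideal.span (u '' (S : Set (Fin (maximalIdeal (Y.presheaf.stalk x)).spanFinrank))) := by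
    have h1 : Ideal.span (f x '' (T : Set Y.IdealSheafData)) = T.sup fun K => Ideal.span {f x K} :=
      (Finset.sup_span_singleton_eq_span_image T (f x)).symm
    have h2 : (T.sup fun K => Ideal.span {f x K}) =
        T.attach.sup fun K : T => Ideal.span {u (ι ⟨K.1, (hT K.1 K.2).1, (hT K.1 K.2).2⟩)} := by
      rw [← Finset.sup_attach]
      refine Finset.sup_congr rfl fun K _ => ?_
      rw [← hf x K.1 (hT K.1 K.2).1 (hT K.1 K.2).2, hι ⟨K.1, (hT K.1 K.2).1, (hT K.1 K.2).2⟩]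
    rw [h1, h2, Finset.sup_span_singleton_eq_span_image, Finset.coe_attach, Set.image_univ,
      hS, Finset.coe_image, Finset.coe_attach, Set.image_univ, ← Set.range_comp]
    rfl
  refine ⟨?_, ?_⟩
  · rw [hspan]
    exact isRegularLocalRing_quotient_span_image rfl u hu S
  · intro D hDE hxD hDT
    set k := ι ⟨D, hDE, hxD⟩ with hk
    have hkS : k ∉ (S : Set (Fin (maximalIdeal (Y.presheaf.stalk x)).spanFinrank)) := by
      rw [hS, Finset.coe_image]
      rintro ⟨K, -, hK⟩
      have hKD : (⟨K.1, (hT K.1 K.2).1, (hT K.1 K.2).2⟩ :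
          {D : Y.IdealSheafData // D ∈ E ∧ x ∈ D.support}) = ⟨D, hDE, hxD⟩ := hιinj hK
      have hKD' : K.1 = D := congrArg Subtype.val hKD
      exact hDT (hKD' ▸ K.2)
    -- `f_D = v u_k` with `v` a unit, and `u_k ∉ (u_S)`, a prime ideal
    have hgen : Ideal.span {f x D} = Ideal.span {u k} := by rw [← hf x D hDE hxD, hι ⟨D, hDE, hxD⟩]
    obtain ⟨v, hv, hfv⟩ := exists_isUnit_mul_eq_of_span_singleton_eq hgen
    haveI hprime : (Ideal.span (u '' (S : Set _))).IsPrime := isPrime_span_image rfl u hu S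
    haveI : IsDomain (Y.presheaf.stalk x ⧸ Ideal.span (u '' (S : Set _))) :=
      Ideal.Quotient.isDomain _
    rw [hspan]
    refine mem_nonZeroDivisors_of_ne_zero fun h0 => ?_
    rw [Ideal.Quotient.eq_zero_iff_mem, hfv] at h0
    have huk : u k ∈ Ideal.span (u '' (S : Set _)) :=
      ((hprime.mem_or_mem h0).resolve_left fun hvmem =>
        hprime.ne_top (Ideal.eq_top_of_isUnit_mem _ hvmem hv))
    exact not_mem_span_image_of_not_mem rfl u hu hkS huk

end BoundaryData

/-! ## The key computation: the specialized saturated centre at a point of the fibre -/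

section Key

variable {X Xk : Scheme.{u}} [IsLocallyNoetherian X] (ι : Xk ⟶ X)

/-- **The stalk of the specialized saturated centre.** Let `ι : X_k → X`, `x ∈ X_k`, `y = ι x`,
`ψ : 𝒪_{X,y} → 𝒪_{X_k,x}`, and suppose that `J := (ι^*C)_x` is prime and that for every `D ∈ B`
some element of `D_y` maps outside `J`. Then `(ι^* satCentre C B)_x = J`: an element `c` with
`(∏_{D∈B} D_y)ⁿ c ⊆ C_y` satisfies `pⁿ ψ(c) ∈ J` for the product `p ∉ J` of those images.
[folklore] -/
theorem stalkIdeal_comap_satCentre_eq (C : X.IdealSheafData) (B : Finset X.IdealSheafData)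
    (x : Xk) (hprime : (stalkIdeal (C.comap ι) x).IsPrime)
    (htr : ∀ D ∈ B, ∃ p ∈ stalkIdeal D (ι x), (ι.stalkMap x).hom p ∉ stalkIdeal (C.comap ι) x) :
    stalkIdeal ((satCentre C B).comap ι) x = stalkIdeal (C.comap ι) x := by
  classical
  refine le_antisymm ?_ (stalkIdeal_mono (comap_mono _ (le_satCentre C B)) x)
  set ψ := (ι.stalkMap x).hom with hψ
  set J := stalkIdeal (C.comap ι) x with hJ
  have hJmap : J = (stalkIdeal C (ι x)).map ψ := stalkIdeal_comap_eq_map_stalkMap ι C x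
  -- the product `p` of the chosen elements
  choose! p hp hpJ using htr
  have hPmem : ∏ D ∈ B, p D ∈ ∏ D ∈ B, stalkIdeal D (ι x) :=
    Ideal.prod_mem_prod fun D hD => hp D hD
  have hPJ : ψ (∏ D ∈ B, p D) ∉ J := by
    rw [map_prod]
    intro hmem
    obtain ⟨D, hD, hDJ⟩ := (Ideal.IsPrime.prod_mem_iff (hp := hprime)).mp hmem
    exact hpJ D hD hDJ
  rw [stalkIdeal_comap_eq_map_stalkMap, stalkIdeal_satCentre, Ideal.map_iSup]
  refine iSup_le fun n => ?_
  rw [Ideal.map_le_iff_le_comap]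
  intro c hc
  rw [Ideal.mem_comap]
  have hcn : (∏ D ∈ B, p D) ^ n * c ∈ stalkIdeal C (ι x) := by
    have h := Submodule.mem_colon.mp hc ((∏ D ∈ B, p D) ^ n) (Ideal.pow_mem_pow hPmem n)
    rwa [smul_eq_mul, mul_comm] at h
  have himg : ψ ((∏ D ∈ B, p D) ^ n) * ψ c ∈ J := by
    rw [← map_mul, hJmap]
    exact Ideal.mem_map_of_mem ψ hcn
  rcases hprime.mem_or_mem himg with h | h
  · rw [map_pow] at h
    exact absurd (hprime.mem_of_pow_mem n h) hPJ
  · exact h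

end Key

/-! ## Cartier restrictions in the fibre give non-zero-divisors in the quotient stalks -/

section CartierStalk

variable {Y : Scheme.{u}}

/-- **If `P` restricts to an effective Cartier divisor on `V(I)` and `P_x = (g)`, then `g` is a
non-zero-divisor modulo `I_x`** (`𝒪_{V(I),x} = 𝒪_{Y,x}/I_x`, in which the image of `g`
generates the stalk of the restricted divisor, a principal ideal of a non-zero-divisor).
[cite: StacksProject, Tag 056P] -/
theorem mk_mem_nonZeroDivisors_of_isEffectiveCartier_comap_subschemeι {I P : Y.IdealSheafData}
    (h : IsEffectiveCartier (P.comap I.subschemeι)) {x : Y} (hx : x ∈ I.support)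
    {g : Y.presheaf.stalk x} (hg : stalkIdeal P x = Ideal.span {g}) :
    Ideal.Quotient.mk (stalkIdeal I x) g ∈ nonZeroDivisors (Y.presheaf.stalk x ⧸ stalkIdeal I x) := by
  obtain ⟨z, rfl⟩ : x ∈ Set.range I.subschemeι := by
    rw [range_subschemeι]
    exact hx
  set φ := (I.subschemeι.stalkMap z).hom with hφ
  have hsurj : Function.Surjective φ := I.subschemeι.stalkMap_surjective z
  have hker : RingHom.ker φ = stalkIdeal I (I.subschemeι z) := ker_stalkMap_subschemeι I z
  obtain ⟨t, ht, htgen⟩ := h.exists_stalkIdeal_eq_span z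
  have hstalk : stalkIdeal (P.comap I.subschemeι) z = Ideal.span {φ g} := by
    rw [stalkIdeal_comap_eq_map_stalkMap, hg, Ideal.map_span, Set.image_singleton]
  have hφg : φ g ∈ nonZeroDivisors _ :=
    mem_nonZeroDivisors_of_span_singleton_eq (hstalk.symm.trans htgen) ht
  -- transport along `𝒪_{Y,x}/I_x ≅ 𝒪_{Y,x}/ker φ ≅ 𝒪_{V(I),z}`
  let e := (Ideal.quotEquivOfEq hker.symm).trans (RingHom.quotientKerEquivOfSurjective hsurj)
  refine mem_nonZeroDivisors_of_map_ringEquiv e ?_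
  have he : e (Ideal.Quotient.mk (stalkIdeal I (I.subschemeι z)) g) = φ g := rfl
  rw [he]
  exact hφg

end CartierStalk

/-! ## Simple normal crossings in the fibre -/

section Fibre

variable {D : Type u} (k : Type u) [CommRing D] [Field k] [Algebra D k]
  {X Xk : Scheme.{u}} [IsLocallyNoetherian X] [IsLocallyNoetherian Xk]
  (q : X ⟶ Spec (.of D)) {ι : Xk ⟶ X} {sk : Xk ⟶ Spec (.of k)}

/-- **Simple normal crossings specialize to the fibres of a family with smooth saturated
strata** (the fibre half of the spreading-out of BGMW Def. 3.1.3 (2)). Let `q : X → Spec D`,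
`ι : X_k → X` the fibre over a field-valued point, `E` a boundary and `C` a centre on `X`.
Suppose that `ι^*E` has simple normal crossings on `X_k`, and that for all finite sets `B, T` of
members of `E`: the saturated stratum `V(satCentre C B ⊔ ∑_{K∈T} K) → Spec D` is smooth, and
every `D₀ ∈ B ∖ T` in `E` restricts on it to an effective Cartier divisor whose zero scheme is
flat over `Spec D`. Then `HasSNCWith (ι^*E) (ι^*C)`.
[cite: BierstoneGrigorievMilmanWlodarczyk2011, Def. 3.1.1 and Def. 3.1.3 (2)] -/
theorem hasSNCWith_comap_of_smooth_satCentre (HX : IsPullback ι sk q (specOfAlgebra D k))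
    (E : List X.IdealSheafData) (C : X.IdealSheafData)
    (hEk : HasSNC (E.map fun K => K.comap ι))
    (hsm : ∀ B T : Finset X.IdealSheafData, (∀ K ∈ B, K ∈ E) → (∀ K ∈ T, K ∈ E) →
      Smooth ((satCentre C B ⊔ T.sup id).subschemeι ≫ q))
    (hcart : ∀ B T : Finset X.IdealSheafData, (∀ K ∈ B, K ∈ E) → (∀ K ∈ T, K ∈ E) →
      ∀ D₀ ∈ E, D₀ ∈ B → D₀ ∉ T →
        IsEffectiveCartier (D₀.comap (satCentre C B ⊔ T.sup id).subschemeι) ∧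
        Flat ((D₀.comap (satCentre C B ⊔ T.sup id).subschemeι).subschemeι ≫
          (satCentre C B ⊔ T.sup id).subschemeι ≫ q)) :
    HasSNCWith (E.map fun K => K.comap ι) (C.comap ι) := by
  classical
  set Ek : List Xk.IdealSheafData := E.map fun K => K.comap ι with hEkdef
  -- generators of the fibre divisors through the points
  have hgen : ∀ (x : Xk) (Dk : Xk.IdealSheafData), ∃ f : Xk.presheaf.stalk x,
      (Dk ∈ Ek ∧ x ∈ Dk.support) → stalkIdeal Dk x = Ideal.span {f} := by
    intro x Dk
    by_cases h : Dk ∈ Ek ∧ x ∈ Dk.support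
    · obtain ⟨f, -, -, hf⟩ := hEk.exists_generator_of_mem h.1 h.2
      exact ⟨f, fun _ => hf⟩
    · exact ⟨1, fun h' => absurd h' h⟩
  choose f hf using hgen
  -- regularity of the fibre subschemes of the smooth strata
  have hregV : ∀ B T : Finset X.IdealSheafData, (∀ K ∈ B, K ∈ E) → (∀ K ∈ T, K ∈ E) →
      Scheme.IsRegular ((satCentre C B ⊔ T.sup id).comap ι).subscheme := by
    intro B T hB hT
    haveI := hsm B T hB hT
    exact isRegular_subscheme_comap_of_smooth q _ HX
  refine hasSNCWith_of_nonZeroDivisor_data Ek (C.comap ι) f (fun x Dk hDk hx => hf x Dk ⟨hDk, hx⟩)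
    (fun x T hT => hEk.nonZeroDivisor_data f (fun x Dk hDk hx => hf x Dk ⟨hDk, hx⟩) x T hT)
    fun x hxC T hT => ?_
  -- ### the centre part at `x ∈ V(ι^*C)`
  set J := stalkIdeal (C.comap ι) x with hJ
  -- `J` is prime: `V(C)` is smooth (`B = T = ∅`)
  have hCsat : satCentre C ∅ ⊔ (∅ : Finset X.IdealSheafData).sup id = C := by
    rw [Finset.sup_empty, satCentre, Finset.prod_empty]
    refine le_antisymm ?_ ?_
    · refine sup_le (iSup_le fun n => ?_) bot_le
      rw [one_pow, one_eq_top, colon_top]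
    · exact le_sup_of_le_left (le_satCentre C ∅)
  have hregC : Scheme.IsRegular (C.comap ι).subscheme := by
    have h := hregV ∅ ∅ (by simp) (by simp)
    rwa [hCsat] at h
  haveI hJprime : J.IsPrime := by
    haveI := isRegularLocalRing_stalk_quotient_stalkIdeal hregC hxC
    haveI := isDomain_of_isRegularLocalRing (Xk.presheaf.stalk x ⧸ J)
    exact (Ideal.Quotient.isDomain_iff_prime _).mp inferInstance
  -- the model finite sets: `B` = members of `E` whose fibre is transversal to `C` at `x`,
  -- `Tm` = members of `E` whose fibre lies in `T`
  set B : Finset X.IdealSheafData :=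
    E.toFinset.filter fun K => ¬ stalkIdeal (K.comap ι) x ≤ J with hBdef
  set Tm : Finset X.IdealSheafData := E.toFinset.filter fun K => K.comap ι ∈ T with hTmdef
  have hB : ∀ K ∈ B, K ∈ E := fun K hK => List.mem_toFinset.mp (Finset.mem_filter.mp hK).1
  have hTm : ∀ K ∈ Tm, K ∈ E := fun K hK => List.mem_toFinset.mp (Finset.mem_filter.mp hK).1
  have hTmimg : Tm.image (fun K => K.comap ι) = T := by
    ext Dk
    constructor
    · intro h
      obtain ⟨K, hK, rfl⟩ := Finset.mem_image.mp h
      exact (Finset.mem_filter.mp hK).2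
    · intro hDk
      obtain ⟨hDkE, -, -⟩ := hT Dk hDk
      obtain ⟨K, hKE, rfl⟩ := List.mem_map.mp hDkE
      exact Finset.mem_image.mpr ⟨K, Finset.mem_filter.mpr ⟨List.mem_toFinset.mpr hKE, hDk⟩, rfl⟩
  set V : X.IdealSheafData := satCentre C B ⊔ Tm.sup id with hVdef
  -- the key computation: `(ι^* satCentre C B)_x = J`
  have hkey : stalkIdeal ((satCentre C B).comap ι) x = J := by
    refine stalkIdeal_comap_satCentre_eq ι C B x hJprime fun K hK => ?_
    have hKle : ¬ stalkIdeal (K.comap ι) x ≤ J := (Finset.mem_filter.mp hK).2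
    rw [stalkIdeal_comap_eq_map_stalkMap, Ideal.map_le_iff_le_comap] at hKle
    obtain ⟨p, hp, hpJ⟩ := Set.not_subset.mp hKle
    exact ⟨p, hp, hpJ⟩
  -- the stalk of `ι^*V` at `x` is `J + (f_T)`
  have hspanT : stalkIdeal (T.sup id) x = Ideal.span (f x '' (T : Set Xk.IdealSheafData)) := by
    rw [stalkIdeal_finsetSup, ← Finset.sup_span_singleton_eq_span_image]
    refine Finset.sup_congr rfl fun Dk hDk => ?_
    obtain ⟨hDkE, hxDk, -⟩ := hT Dk hDk
    exact hf x Dk ⟨hDkE, hxDk⟩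
  have hVstalk : stalkIdeal (V.comap ι) x = J ⊔ Ideal.span (f x '' (T : Set Xk.IdealSheafData)) := by
    rw [hVdef, (map_gc ι).l_sup, stalkIdeal_sup, hkey, comap_finsetSup, hTmimg, hspanT]
  have hfm : ∀ Dk ∈ T, f x Dk ∈ maximalIdeal (Xk.presheaf.stalk x) := by
    intro Dk hDk
    obtain ⟨hDkE, hxDk, -⟩ := hT Dk hDk
    have h := (mem_support_iff_stalkIdeal_le Dk x).mp hxDk
    rw [hf x Dk ⟨hDkE, hxDk⟩, Ideal.span_singleton_le_iff_mem] at h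
    exact h
  have hxV : x ∈ (V.comap ι).support := by
    rw [mem_support_iff_stalkIdeal_le, hVstalk]
    refine sup_le ((mem_support_iff_stalkIdeal_le _ x).mp hxC) ?_
    rw [Ideal.span_le]
    rintro _ ⟨Dk, hDk, rfl⟩
    exact hfm Dk hDk
  refine ⟨?_, ?_⟩
  · -- regularity of `𝒪_x / (J + (f_T))`
    have h := isRegularLocalRing_stalk_quotient_stalkIdeal (hregV B Tm hB hTm) hxV
    rwa [hVstalk] at h
  · -- the non-zero-divisor property of `f_D`, `D` transversal and not in `T`
    intro Dk hDkE hxDk hfJ hDkT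
    obtain ⟨K, hKE, rfl⟩ := List.mem_map.mp hDkE
    have hKB : K ∈ B := by
      refine Finset.mem_filter.mpr ⟨List.mem_toFinset.mpr hKE, fun hle => hfJ ?_⟩
      rw [hf x _ ⟨hDkE, hxDk⟩, Ideal.span_singleton_le_iff_mem] at hle
      exact hle
    have hKTm : K ∉ Tm := fun hK => hDkT (Finset.mem_filter.mp hK).2
    obtain ⟨hcartK, hflatK⟩ := hcart B Tm hB hTm K hKE hKB hKTm
    haveI := hflatK
    have hfib : IsEffectiveCartier ((K.comap ι).comap (V.comap ι).subschemeι) :=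
      isEffectiveCartier_comap_comap_subschemeι k q V K hcartK HX
    have h := mk_mem_nonZeroDivisors_of_isEffectiveCartier_comap_subschemeι hfib hxV
      (hf x _ ⟨hDkE, hxDk⟩)
    exact mem_nonZeroDivisors_mk_of_eq hVstalk h

end Fibre

end Literature.AlgebraicGeometry.Resolution

end
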